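import Literature.NumberTheory.Automorphic.CMPrincipalSeriesHTraceOrbitalForm   -- ★ (4.9.4)-H: the frame (carriers, `cmBorelTriple`, `IsRegularElt`)
import Literature.NumberTheory.Automorphic.HaarNormalizedIntegralTransport      -- ★ `ae_comp_continuousMulEquiv_of_ae`
import Literature.NumberTheory.Automorphic.CMTorusRegularAEPairwise             -- ★ `ae_isUnit_torusEntry_sub_three`
import Literature.NumberTheory.Rogawski1990.EndoscopicLeviTorusTransport        -- ★ `exists_leviTorus_continuousMulEquiv`, `isLocalGRegular_of_fst_eq_glDiagonal`
import Literature.NumberTheory.Rogawski1990.GRegularLocalisation                -- ★ `isLocalGRegular_out_mk`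
import Literature.NumberTheory.Rogawski1990.LocalCentralizerTorusMeasureCM      -- ★ `isRegularElt_fst_snd_of_isLocalGRegular`
import HarnessLib

/-!
# F0 · P3c · line LH6 «StCharTS» — road (D) «DEEP-FL», glue «HAE-H»: on `T_H = T₂ × U(Φ₁)_v`, Haar-almost every `(t, u)` is regular AND `G`-regular
# (the `hae` binder of ★ `smoothTrace_cmPrincipalSeriesH_eq_inv_mul_integral` ∕ ★ p849562 ∕ ★ p849681 at `P_H := IsLocalGRegular L v`, as a named lemma)

Cell `pub/hodgecm-mathlib`, crux H413 = `stmt-HodgeConjecture-24833` (`--supports` lane, helper), route HCCMUnconditional; seat LH7-p04 (g2) (DEFAULT «(2) HAE-H» announced on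
the LH6 board 2026-09-02T06:01Z); road owner LH6-p03 (g0) (`F0/P3b/LH6-p03/g0/ROAD-D.status.v5.txt` a06e459eb0272f5d, (c₄)-H feeder of the (D-c) assembly).  THEOREMS ONLY (★-only
imports; no definition ∕ instance ∕ notation ∕ named fact ∕ `sorry`).  HONEST LABEL: road-(D) glue, count-neutral — nothing here closes (S-X) `stub_StXIGSt`; HC_CM is proved only
modulo the 7 printed citations (2 remaining: hLiu418 = stmt-HodgeConjecture-24832, h413 = stmt-HodgeConjecture-24833) until rung 0 closes.

THE MATHEMATICS ([Rogawski1990, §4.3 p. 42, §4.9 p. 55]; [HarishChandra1970, Part I §3]).  The torus transport `Ψ : T₂ × U(Φ₁)_v ≃ T₃` (★ `exists_leviTorus_continuousMulEquiv`,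
`Ψ(t, u) = ι_v(t, u) = diag(d₀, γ₂(t, u), d₁)` for `t = diag(d₀, d₁)`) carries the product Haar measure to a Haar measure on `T₃`; the walls `{dᵢ = dⱼ}` of `T₃` are Haar-null
(★ `ae_isUnit_torusEntry_sub_three`); off the walls `ι_v(t, u)` has pairwise distinct diagonal entries, so `(t, u)` is `G`-regular (★ `isLocalGRegular_of_fst_eq_glDiagonal`),
hence `t` is regular in `U(Φ₂)_v` (★ `isRegularElt_fst_snd_of_isLocalGRegular`) and the chosen representative `⟦(t, u)⟧.out` is `G`-regular (★ `isLocalGRegular_out_mk`).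
The statement is the pattern of ★ `F0P3bInducedCharTransferSigned` (:281–316) made a lemma, so that the (D-c) assembler discharges `hae` by name.

* `ae_ae_isRegularElt_and_isLocalGRegular` — for ALL Haar measures `μ_T` on `T₂` and `ν₁` on `U(Φ₁)_v`:
  `∀ᵐ t ∂μ_T, ∀ᵐ u ∂ν₁, IsRegularElt t ∧ IsLocalGRegular L v ⟦(t, u)⟧.out`.

## References
* [Rogawski1990] J. D. Rogawski, *Automorphic Representations of Unitary Groups in Three Variables*, Ann. of Math. Stud. 123 (1990), §4.3 p. 42; §4.9 p. 55.
* [HarishChandra1970] Harish-Chandra (notes by G. van Dijk), *Harmonic Analysis on Reductive p-adic Groups*, LNM 162 (1970), Part I §3.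
-/

set_option autoImplicit false
-- the mandated namespace has the single-problem summit's repeated segment (`HodgeConjecture.HodgeConjecture`)
set_option linter.dupNamespace false

noncomputable section

open NumberField IsDedekindDomain MeasureTheory MeasureTheory.Measure Topology Filter Set
open Literature.NumberTheory.Rogawski1990 Literature.NumberTheory.Automorphic Literature.NumberTheory.Automorphic.UnitaryGroup
open scoped Matrix MatrixGroups NNReal ENNReal

namespace Summit.HodgeConjecture.HodgeConjecture.Cruxes.H413.F0P3cStCharTSHaeH

section CM

variable (L : Type) [Field L] [NumberField L] [IsCMField L]

set_option maxHeartbeats 1600000 in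
set_option synthInstance.maxHeartbeats 400000 in
/-- **HAE-H.**  At every finite place `v` of `L⁺`, for every Haar measure `μ_T` on the diagonal torus `T₂` of `U(Φ₂)(L⁺_v)` and `ν₁` on `U(Φ₁)(L⁺_v)` (any Borel structures on the
two factors): for `μ_T`-a.e. `t` and `ν₁`-a.e. `u`, `t` is regular semisimple in `U(Φ₂)_v` and the representative `⟦(t, u)⟧.out` of the `H_v`-class of `(t, u)` is `G`-REGULAR
(`IsLocalGRegular L v`) — the `hae` binder of ★ `smoothTrace_cmPrincipalSeriesH_eq_inv_mul_integral` ∕ ★ `normalizedOrbitalIntegralH_eq_twoCoset` ∕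
★ `classOrbitalIntegralH_eq_twoCoset_of_spectral` at `P_H := IsLocalGRegular L v`. [cite: Rogawski1990, §4.3 p. 42; §4.9 p. 55] [cite: HarishChandra1970, Part I §3 Lemma 13] -/
theorem ae_ae_isRegularElt_and_isLocalGRegular (v : HeightOneSpectrum (𝓞 ↥(maximalRealSubfield L)))
    [MeasurableSpace ↥(unitaryGroupOfForm (conjLocal L (IsCMField.complexConj L) v) (cmLocalForm L 2 v))] [BorelSpace ↥(unitaryGroupOfForm (conjLocal L (IsCMField.complexConj L) v) (cmLocalForm L 2 v))] [MeasurableSpace ((cmDatum L 1 (Matrix.of fun i j : Fin 1 => if i.val + j.val + 1 = 1 then (1 : L) else 0)).Local v)] [BorelSpace ((cmDatum L 1 (Matrix.of fun i j : Fin 1 => if i.val + j.val + 1 = 1 then (1 : L) else 0)).Local v)]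
    (μT : Measure ↥(cmBorelTriple L 2 v).M) [μT.IsHaarMeasure] (ν₁ : Measure ((cmDatum L 1 (Matrix.of fun i j : Fin 1 => if i.val + j.val + 1 = 1 then (1 : L) else 0)).Local v)) [ν₁.IsHaarMeasure] :
    ∀ᵐ t : ↥(cmBorelTriple L 2 v).M ∂μT, ∀ᵐ u : ((cmDatum L 1 (Matrix.of fun i j : Fin 1 => if i.val + j.val + 1 = 1 then (1 : L) else 0)).Local v) ∂ν₁,
      IsRegularElt ((t : ↥(unitaryGroupOfForm (conjLocal L (IsCMField.complexConj L) v) (cmLocalForm L 2 v))) : GL (Fin 2) (LocalRing L v)) ∧ IsLocalGRegular L v (Quotient.out (ConjClasses.mk (((t : ↥(unitaryGroupOfForm (conjLocal L (IsCMField.complexConj L) v) (cmLocalForm L 2 v))) : ((cmDatum L 2 (Matrix.of fun i j : Fin 2 => if i.val + j.val + 1 = 2 then (1 : L) else 0)).Local v)), u))) := by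
  -- carriers: the two factors, the product, and `U(Φ₃)_v` with its diagonal torus `T₃` (local Borel structure)
  haveI : LocallyCompactSpace ↥(unitaryGroupOfForm (conjLocal L (IsCMField.complexConj L) v) (cmLocalForm L 2 v)) := locallyCompactSpace_local (IsCMField.complexConj L) 2 _ v
  haveI : SecondCountableTopology ↥(unitaryGroupOfForm (conjLocal L (IsCMField.complexConj L) v) (cmLocalForm L 2 v)) := secondCountableTopology_local (IsCMField.complexConj L) 2 _ v
  haveI : T2Space ↥(unitaryGroupOfForm (conjLocal L (IsCMField.complexConj L) v) (cmLocalForm L 2 v)) := t2Space_cmDatum_local 2 L (Matrix.of fun i j : Fin 2 => if i.val + j.val + 1 = 2 then (1 : L) else 0) v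
  haveI : NonarchimedeanGroup ↥(unitaryGroupOfForm (conjLocal L (IsCMField.complexConj L) v) (cmLocalForm L 2 v)) := nonarchimedeanGroup_cmLocal L 2 v
  haveI : LocallyCompactSpace ((cmDatum L 1 (Matrix.of fun i j : Fin 1 => if i.val + j.val + 1 = 1 then (1 : L) else 0)).Local v) := locallyCompactSpace_local (IsCMField.complexConj L) 1 _ v
  haveI : SecondCountableTopology ((cmDatum L 1 (Matrix.of fun i j : Fin 1 => if i.val + j.val + 1 = 1 then (1 : L) else 0)).Local v) := secondCountableTopology_local (IsCMField.complexConj L) 1 _ v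
  haveI : T2Space ((cmDatum L 1 (Matrix.of fun i j : Fin 1 => if i.val + j.val + 1 = 1 then (1 : L) else 0)).Local v) := t2Space_cmDatum_local 1 L (Matrix.of fun i j : Fin 1 => if i.val + j.val + 1 = 1 then (1 : L) else 0) v
  haveI : NonarchimedeanGroup ((cmDatum L 1 (Matrix.of fun i j : Fin 1 => if i.val + j.val + 1 = 1 then (1 : L) else 0)).Local v) := nonarchimedeanGroup_cmLocal L 1 v
  haveI : LocallyCompactSpace ↥(unitaryGroupOfForm (conjLocal L (IsCMField.complexConj L) v) (cmLocalForm L 3 v)) := locallyCompactSpace_local (IsCMField.complexConj L) 3 _ v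
  haveI : SecondCountableTopology ↥(unitaryGroupOfForm (conjLocal L (IsCMField.complexConj L) v) (cmLocalForm L 3 v)) := secondCountableTopology_local (IsCMField.complexConj L) 3 _ v
  haveI : NonarchimedeanGroup ↥(unitaryGroupOfForm (conjLocal L (IsCMField.complexConj L) v) (cmLocalForm L 3 v)) := nonarchimedeanGroup_cmLocal L 3 v
  haveI : T1Space (LocalRing L v) := inferInstance
  letI : MeasurableSpace ↥(unitaryGroupOfForm (conjLocal L (IsCMField.complexConj L) v) (cmLocalForm L 3 v)) := borel _
  haveI : BorelSpace ↥(unitaryGroupOfForm (conjLocal L (IsCMField.complexConj L) v) (cmLocalForm L 3 v)) := ⟨rfl⟩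
  have hT2cl := isClosed_torusU_of_t1Space (conjLocal L (IsCMField.complexConj L) v) (cmLocalForm L 2 v)
  haveI : LocallyCompactSpace ↥(cmBorelTriple L 2 v).M := hT2cl.isClosedEmbedding_subtypeVal.locallyCompactSpace
  haveI : SecondCountableTopology ↥(cmBorelTriple L 2 v).M := TopologicalSpace.Subtype.secondCountableTopology _
  haveI : SigmaCompactSpace ↥(cmBorelTriple L 2 v).M := sigmaCompactSpace_of_locallyCompact_secondCountable
  haveI : SigmaCompactSpace ((cmDatum L 1 (Matrix.of fun i j : Fin 1 => if i.val + j.val + 1 = 1 then (1 : L) else 0)).Local v) := sigmaCompactSpace_of_locallyCompact_secondCountable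
  have hT3cl := isClosed_torusU_of_t1Space (conjLocal L (IsCMField.complexConj L) v) (cmLocalForm L 3 v)
  haveI : LocallyCompactSpace ↥(cmBorelTriple L 3 v).M := hT3cl.isClosedEmbedding_subtypeVal.locallyCompactSpace
  haveI : SecondCountableTopology ↥(cmBorelTriple L 3 v).M := TopologicalSpace.Subtype.secondCountableTopology _
  haveI hσT : SigmaFinite μT := inferInstance
  haveI hσ₁ : SigmaFinite ν₁ := inferInstance
  haveI : (μT.prod ν₁).IsHaarMeasure := inferInstance
  let μT₃ : Measure ↥(cmBorelTriple L 3 v).M := Measure.haar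
  -- the torus transport and the regular locus of `T₃`
  obtain ⟨Ψ, hΨ⟩ := exists_leviTorus_continuousMulEquiv L v
  have hA := ae_comp_continuousMulEquiv_of_ae Ψ (μT.prod ν₁) μT₃ (ae_isUnit_torusEntry_sub_three L v μT₃)
  have hA2 := Measure.ae_ae_of_ae_prod hA
  filter_upwards [hA2] with t ht
  filter_upwards [ht] with u hu
  -- a diagonal writing of `t` (a copy of `t.2`)
  have ht2 : ∃ d' : Fin 2 → (LocalRing L v)ˣ, glDiagonal 2 (LocalRing L v) d' = ((t : ↥(unitaryGroupOfForm (conjLocal L (IsCMField.complexConj L) v) (cmLocalForm L 2 v))) : GL (Fin 2) (LocalRing L v)) := t.2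
  obtain ⟨d', hd'⟩ := ht2
  -- the entries of `Ψ (t, u) = ι_v (t, u) = diag(d'₀, γ₂, d'₁)`
  have hι := endoEmbLocal_eq_glDiagonal_of_fst_eq L v (γH := (((t : ↥(unitaryGroupOfForm (conjLocal L (IsCMField.complexConj L) v) (cmLocalForm L 2 v))) : ((cmDatum L 2 (Matrix.of fun i j : Fin 2 => if i.val + j.val + 1 = 2 then (1 : L) else 0)).Local v)), u)) hd'
  have hte : ∀ i, torusEntry (conjLocal L (IsCMField.complexConj L) v) (cmLocalForm L 3 v) i (Ψ (t, u)) =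
      ![d' 0, (isUnit_finGammaTwo L v (((t : ↥(unitaryGroupOfForm (conjLocal L (IsCMField.complexConj L) v) (cmLocalForm L 2 v))) : ((cmDatum L 2 (Matrix.of fun i j : Fin 2 => if i.val + j.val + 1 = 2 then (1 : L) else 0)).Local v)), u)).unit, d' 1] i := by
    intro i
    refine torusEntry_eq_of_glDiagonal_eq (conjLocal L (IsCMField.complexConj L) v) (cmLocalForm L 3 v) i (Ψ (t, u)) _ ?_
    rw [hΨ (t, u)]
    exact hι.symm
  obtain ⟨h1, -, -⟩ := hu
  simp only [hte] at h1
  have hGreg := isLocalGRegular_of_fst_eq_glDiagonal L v ((((t : ↥(unitaryGroupOfForm (conjLocal L (IsCMField.complexConj L) v) (cmLocalForm L 2 v))) : ((cmDatum L 2 (Matrix.of fun i j : Fin 2 => if i.val + j.val + 1 = 2 then (1 : L) else 0)).Local v))), u) hd' h1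
  exact ⟨(isRegularElt_fst_snd_of_isLocalGRegular L v _ hGreg).1, isLocalGRegular_out_mk hGreg⟩

end CM

end Summit.HodgeConjecture.HodgeConjecture.Cruxes.H413.F0P3cStCharTSHaeH

end
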